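import Summits.CriticalPhenomena.PercolationContinuityZ3.Theorems.PercNearOneGluingNoHeavyLowerTailSahiMixtureLawSubtopSixP1
import Summits.CriticalPhenomena.PercolationContinuityZ3.Theorems.PercNearOneGluingNoHeavyLowerTailSahiMixtureLawSubtopSixP2
import Summits.CriticalPhenomena.PercolationContinuityZ3.Theorems.PercNearOneGluingNoHeavyLowerTailSahiMixtureLawSubtopSixP3
import Summits.CriticalPhenomena.PercolationContinuityZ3.Theorems.PercNearOneGluingNoHeavyLowerTailSahiMixtureLawSubtopSixP54
import Summits.CriticalPhenomena.PercolationContinuityZ3.Theorems.PercNearOneGluingNoHeavyLowerTailSahiMixtureLawSubtopSixPolyA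
import Summits.CriticalPhenomena.PercolationContinuityZ3.Theorems.PercNearOneGluingNoHeavyLowerTailSahiMixtureLawSubtopSixPolyB

/-!
# The (6,5) singleton cell at the LAW level, VI — the assembly: **`bernsteinPos_six_orCoin_five_of_hereditary`**

Support file of the one-cut programme (crux `NoHeavyLowerTail`, stmt-CriticalPhenomena-4575; cell `prim-masterthm`, seat P3, gen 14; HIERARCHY.md §22).  See
`…SahiMixtureLawSubtopSixA` (identity `sahiE_six_orCoin_five_eq`).  RESULT: SUBTOP(6) at the law level (see the theorem docstring); the `n = 6` OR-ladder of the mixture programme is closed.  Generated by `code/lean6/emit6.py`.  HONEST FRAMING: a cell of the hereditary class `𝒦_6`; nothing here asserts (M⁺-k) or `C_k` for `k ≥ 3`. [this work]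
-/

noncomputable section

open scoped Classical

namespace Summit.CriticalPhenomena.PercolationContinuityZ3.Theorems

open Finset Function
open Literature.Combinatorics.Sahi2008
open Literature.Probability.Percolation.BHK2006 (ind_le_one ind_inter)
open Literature.Probability.Percolation.DecisionTree (ind ind_of_mem ind_of_not_mem ind_nonneg)

namespace SahiMixture

section LawSubtopSixFinal

variable {α : Type*} [Fintype α] {μ : α → ℝ} (hμ : ∀ a, 0 ≤ μ a) (hμ1 : ∑ a, μ a = 1) (A : Fin 6 → Set α)

/-- Abstract assembly for the (6,5) cell: a function with the `λ`-expansion `Φ(h) = Σ_{k=1}^{5} (1−h)^k S_k` whose degree-6 Bernstein coefficients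
`P_j = Σ_k C(6−k,j) S_k` (`P_0 = E_6`) are nonnegative is Bernstein-positive of degree 6.  The pieces are fixed by unification (no large rewrites). [this work] -/
theorem bernsteinPos_six_subtop_of_pieces {Φ : ℝ → ℝ} {S1 S2 S3 S4 S5 E6 P1 P2 P3 P4 P5 : ℝ}
    (hΦ : ∀ h, Φ h = (1 - h) ^ 1 * S1 + (1 - h) ^ 2 * S2 + (1 - h) ^ 3 * S3 + (1 - h) ^ 4 * S4 + (1 - h) ^ 5 * S5)
    (e0 : S1 + S2 + S3 + S4 + S5 = E6) (e1 : 5 * S1 + 4 * S2 + 3 * S3 + 2 * S4 + S5 = P1) (e2 : 10 * S1 + 6 * S2 + 3 * S3 + S4 = P2)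
    (e3 : 10 * S1 + 4 * S2 + S3 = P3) (e4 : 5 * S1 + S2 = P4) (e5 : S1 = P5)
    (h0 : 0 ≤ E6) (h1 : 0 ≤ P1) (h2 : 0 ≤ P2) (h3 : 0 ≤ P3) (h4 : 0 ≤ P4) (h5 : 0 ≤ P5) : BernsteinPos 6 Φ := by
  subst e0 e1 e2 e3 e4 e5
  refine (((((((bernsteinPos_pow 0 6).smul h0).add ((bernsteinPos_pow 1 5).smul h1)).add ((bernsteinPos_pow 2 4).smul h2)).add
    ((bernsteinPos_pow 3 3).smul h3)).add ((bernsteinPos_pow 4 2).smul h4)).add ((bernsteinPos_pow 5 1).smul h5)).congr fun h _ _ => ?_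
  rw [hΦ h]
  ring

include hμ hμ1 in
set_option maxHeartbeats 40000000 in
set_option maxRecDepth 262144 in
/-- **THE (6,5) SINGLETON CELL ON THE HEREDITARY CLASS (law level) — SUBTOP(6).**  For any probability weight on a finite type and six events
`(A_0,…,A_5)` with every Sahi row of the ∩-closed family nonnegative, OR-ing an independent coin into five of the six members gives
`h ↦ E_6(A_0∪H,…,A_4∪H,A_5)` Bernstein-positive of degree `6` (members written `⋂_{i∈{j}} A_i`).  Closes the `n = 6` OR-ladder of the mixture
programme at the law level: |G| ≤ 1 TRUE (every n), 2 ≤ |G| ≤ 4 FALSE (`hmixClosure_fails`), |G| = 5 TRUE (this theorem), |G| = 6 TRUE from the top row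
(`bernsteinPos_six_orCoin_top`). [this work] -/
theorem bernsteinPos_six_orCoin_five_of_hereditary (hA : HereditaryAllOrders μ A) :
    BernsteinPos 6 (fun h => sahiE (coinWeight μ h) 6 ![ind (orCoin (⋂ i ∈ ({0} : Finset (Fin 6)), A i) true), ind (orCoin (⋂ i ∈ ({1} : Finset (Fin 6)), A i) true),
        ind (orCoin (⋂ i ∈ ({2} : Finset (Fin 6)), A i) true), ind (orCoin (⋂ i ∈ ({3} : Finset (Fin 6)), A i) true),
        ind (orCoin (⋂ i ∈ ({4} : Finset (Fin 6)), A i) true), ind (orCoin (⋂ i ∈ ({5} : Finset (Fin 6)), A i) false)]) := by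
  have hE6 : 0 ≤ sahiE μ 6 ![ind (⋂ i ∈ ({0} : Finset (Fin 6)), A i), ind (⋂ i ∈ ({1} : Finset (Fin 6)), A i), ind (⋂ i ∈ ({2} : Finset (Fin 6)), A i),
          ind (⋂ i ∈ ({3} : Finset (Fin 6)), A i), ind (⋂ i ∈ ({4} : Finset (Fin 6)), A i), ind (⋂ i ∈ ({5} : Finset (Fin 6)), A i)] := by
    have h := hA 6 ![({0} : Finset (Fin 6)), {1}, {2}, {3}, {4}, {5}]
    rw [fam6] at h
    exact h
  rw [sahiE_six_biInter_expand A] at hE6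
  have e0 := subtop6_c0_poly (fun S => ex μ (ind (⋂ i ∈ S, A i)))
  beta_reduce at e0
  have e1 := subtop6_c1_poly (fun S => ex μ (ind (⋂ i ∈ S, A i)))
  beta_reduce at e1
  have e2 := subtop6_c2_poly (fun S => ex μ (ind (⋂ i ∈ S, A i)))
  beta_reduce at e2
  have e3 := subtop6_c3_poly (fun S => ex μ (ind (⋂ i ∈ S, A i)))
  beta_reduce at e3
  have e4 := subtop6_c4_poly (fun S => ex μ (ind (⋂ i ∈ S, A i)))
  beta_reduce at e4
  have e5 := subtop6_c5_poly (fun S => ex μ (ind (⋂ i ∈ S, A i)))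
  beta_reduce at e5
  have h1 := subtop6_P1_nonneg hμ hμ1 A hA
  have h2 := subtop6_P2_nonneg hμ hμ1 A hA
  have h3 := subtop6_P3_nonneg hμ hμ1 A hA
  have h4 := subtop6_P4_nonneg hμ hμ1 A hA
  have h5 := subtop6_P5_nonneg hμ A hA
  exact bernsteinPos_six_subtop_of_pieces (fun h => sahiE_six_orCoin_five_eq hμ1 A h) e0 e1 e2 e3 e4 e5 hE6 h1 h2 h3 h4 h5

include hμ hμ1 in
/-- **Corollary (plain form)**: `(A_0,…,A_5) ∈ 𝒦_6` and `H` an independent coin of bias `h ∈ [0,1]` ⇒ `E_6(A_0∪H,…,A_4∪H, A_5) ≥ 0`. [this work] -/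
theorem sahiE_six_orCoin_five_nonneg_of_hereditaryAllOrders (hA : HereditaryAllOrders μ A) {h : ℝ} (h0 : 0 ≤ h) (h1 : h ≤ 1) :
    0 ≤ sahiE (coinWeight μ h) 6 ![ind (orCoin (A 0) true), ind (orCoin (A 1) true), ind (orCoin (A 2) true), ind (orCoin (A 3) true),
      ind (orCoin (A 4) true), ind (orCoin (A 5) false)] := by
  have h := (bernsteinPos_six_orCoin_five_of_hereditary hμ hμ1 A hA).nonneg h0 h1
  simp only [Finset.set_biInter_singleton] at h
  exact h

end LawSubtopSixFinal

end SahiMixture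

end Summit.CriticalPhenomena.PercolationContinuityZ3.Theorems

end
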